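import Summits.CriticalPhenomena.PercolationContinuityZ3.Theorems.PercNearOneGluingNoHeavyLowerTailSahiLatinZeroBottomOneBlock

/-!
# `NoHeavyLowerTail` (crux stmt-CriticalPhenomena-4575), Sahi programme (prim-master-conj gen 52): PRODUCT LATIN-SUM TOOLKIT for the
# two-block zero-bottom theorem — block components of a Latin index, independent re-indexing of the two blocks (36-fold symmetrisation),
# conditional Harris inside one block given the other block, and `Ψ` as a Latin sum

Support file (`--supports stmt-CriticalPhenomena-4575`; small definitions + proofs, no `sorry`, standard axioms).  Memo
`run/shared/lean/prim/prim-l12/FROM-prim-master-conj-g52-ONE-BLOCK.md` §5.  Nothing here asserts the crux, Kahn's conjecture or (C¼).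

THE MATHEMATICS.  A Latin index `ρ : U ⊕ V → Perm (Fin 3)` of the product grid `[3]^{U ⊕ V}` is a pair `(ρ_U, ρ_V)` of Latin indices of the
blocks (`rU`, `rV`); its `k`-th point is `(ρ_U·k, ρ_V·k)` (`lpt_eq_elim`), and the nine MIXED POINTS `(ρ_U·i, ρ_V·j)` (`mixPt`) carry the data a
two-block certificate needs.  Two facts: (i) a sum over all `ρ` is invariant under re-indexing the three `U`-points by `σ` and, INDEPENDENTLY, the
three `V`-points by `τ` (`sum_lperm_cst2`; right multiplication by `cst2 σ τ`), so `36·Σ_ρ Φ(ρ) = Σ_ρ Σ_{σ,τ} Φ(ρ·(σ,τ))`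
(`thirtysix_mul_sum_lperm`); (ii) CONDITIONAL HARRIS INSIDE A BLOCK: for an up-set `K ⊆ [3]^U`, a family `L(ρ_V)` of up-sets of `[3]^U` and a
weight `μ ≥ 0` depending only on the third `U`-point and on `ρ_V`, `Σ_ρ μ·[ρ_U·0 ∈ K][ρ_U·1 ∈ L(ρ_V)] ≤ Σ_ρ μ·[ρ_U·0 ∈ K ∩ L(ρ_V)]`
(`sum_lperm_condHarrisU`, and `…V` for the other block) — the sum over `ρ_V` of the one-block conditional Harris inequality
`sum_lperm_condHarris` of `…ZeroBottomOneBlock`.  Finally `Psi_eq_sum_lperm` writes the zero-bottom functional `Ψ` of `…ZeroBottomPsi` as one Latin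
sum of an explicit integrand `psiD`. [this work]
-/

namespace Summit.CriticalPhenomena.PercolationContinuityZ3.Theorems.SahiLatin

open Finset

section product
variable {U V : Type} [Fintype U] [DecidableEq U] [Fintype V] [DecidableEq V]

/-! ## §1  Block components of a Latin index of the product -/

/-- `U`-component of a Latin index of `[3]^{U ⊕ V}`. [this work] -/
def rU (ρ : LPerm (U ⊕ V)) : LPerm U := fun i => ρ (Sum.inl i)

/-- `V`-component of a Latin index of `[3]^{U ⊕ V}`. [this work] -/
def rV (ρ : LPerm (U ⊕ V)) : LPerm V := fun i => ρ (Sum.inr i)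

omit [Fintype U] [DecidableEq U] [Fintype V] [DecidableEq V] in
/-- The `k`-th point of `ρ` is the pair of the `k`-th points of its components. [this work] -/
theorem lpt_eq_elim (ρ : LPerm (U ⊕ V)) (k : Fin 3) : lpt ρ k = Sum.elim (lpt (rU ρ) k) (lpt (rV ρ) k) := by
  funext i; cases i <;> rfl

/-- The mixed point `(ρ_U·i, ρ_V·j)`. [this work] -/
def mixPt (ρ : LPerm (U ⊕ V)) (i j : Fin 3) : Pt (U ⊕ V) := Sum.elim (lpt (rU ρ) i) (lpt (rV ρ) j)

omit [Fintype U] [DecidableEq U] [Fintype V] [DecidableEq V] in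
/-- Diagonal mixed points are the points of `ρ`. [this work] -/
theorem mixPt_diag (ρ : LPerm (U ⊕ V)) (k : Fin 3) : mixPt ρ k k = lpt ρ k := (lpt_eq_elim ρ k).symm

/-- The group element re-indexing the `U`-points by `σ` and the `V`-points by `τ`. [this work] -/
def cst2 (σ τ : Equiv.Perm (Fin 3)) : LPerm (U ⊕ V) := Sum.elim (fun _ => σ) (fun _ => τ)

omit [Fintype U] [DecidableEq U] [Fintype V] [DecidableEq V] in
/-- `U`-points of `ρ · cst2 σ τ`. [this work] -/
theorem lpt_rU_mul_cst2 (ρ : LPerm (U ⊕ V)) (σ τ : Equiv.Perm (Fin 3)) (k : Fin 3) :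
    lpt (rU (ρ * cst2 σ τ)) k = lpt (rU ρ) (σ k) := by
  funext i; simp [lpt, rU, cst2, Pi.mul_apply, Equiv.Perm.mul_apply]

omit [Fintype U] [DecidableEq U] [Fintype V] [DecidableEq V] in
/-- `V`-points of `ρ · cst2 σ τ`. [this work] -/
theorem lpt_rV_mul_cst2 (ρ : LPerm (U ⊕ V)) (σ τ : Equiv.Perm (Fin 3)) (k : Fin 3) :
    lpt (rV (ρ * cst2 σ τ)) k = lpt (rV ρ) (τ k) := by
  funext i; simp [lpt, rV, cst2, Pi.mul_apply, Equiv.Perm.mul_apply]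

omit [Fintype U] [DecidableEq U] [Fintype V] [DecidableEq V] in
/-- Mixed points of `ρ · cst2 σ τ`. [this work] -/
theorem mixPt_mul_cst2 (ρ : LPerm (U ⊕ V)) (σ τ : Equiv.Perm (Fin 3)) (i j : Fin 3) :
    mixPt (ρ * cst2 σ τ) i j = mixPt ρ (σ i) (τ j) := by
  unfold mixPt; rw [lpt_rU_mul_cst2, lpt_rV_mul_cst2]

/-! ## §2  Independent re-indexing of the two blocks; 36-fold symmetrisation -/

/-- **Independent re-indexing**: `Σ_ρ Φ(ρ · cst2 σ τ) = Σ_ρ Φ(ρ)`. [this work] -/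
theorem sum_lperm_cst2 (Φ : LPerm (U ⊕ V) → ℤ) (σ τ : Equiv.Perm (Fin 3)) :
    ∑ ρ : LPerm (U ⊕ V), Φ (ρ * cst2 σ τ) = ∑ ρ : LPerm (U ⊕ V), Φ ρ :=
  Equiv.sum_comp (Equiv.mulRight (cst2 (U := U) (V := V) σ τ)) Φ

/-- There are `6` permutations of `Fin 3`. [this work] -/
theorem card_perm_fin3 : (Fintype.card (Equiv.Perm (Fin 3)) : ℤ) = 6 := by
  rw [Fintype.card_perm, Fintype.card_fin]; simp [Nat.factorial]

/-- **36-fold symmetrisation**: `36·Σ_ρ Φ(ρ) = Σ_ρ Σ_σ Σ_τ Φ(ρ · cst2 σ τ)`. [this work] -/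
theorem thirtysix_mul_sum_lperm (Φ : LPerm (U ⊕ V) → ℤ) :
    36 * ∑ ρ : LPerm (U ⊕ V), Φ ρ = ∑ ρ : LPerm (U ⊕ V), ∑ σ : Equiv.Perm (Fin 3), ∑ τ : Equiv.Perm (Fin 3), Φ (ρ * cst2 σ τ) := by
  rw [sum_comm]
  conv_rhs => arg 2; ext σ; rw [sum_comm]
  simp only [sum_lperm_cst2, sum_const, card_univ, nsmul_eq_mul, card_perm_fin3]
  ring

/-- The six permutations of `Fin 3`, as an explicit list. [this work] -/
def perms3E : List (Equiv.Perm (Fin 3)) :=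
  [1, Equiv.swap 0 1, Equiv.swap 0 2, Equiv.swap 1 2, Equiv.swap 0 1 * Equiv.swap 0 2, Equiv.swap 0 2 * Equiv.swap 0 1]

/-- **36-fold symmetrisation, list form**: summing `Φ(ρ · cst2 σ τ)` over the `36` pairs from `perms3E` gives `36·Σ_ρ Φ(ρ)`. [this work] -/
theorem sum_lperm_sym36 (Φ : LPerm (U ⊕ V) → ℤ) :
    ∑ ρ : LPerm (U ⊕ V), (perms3E.map fun σ => (perms3E.map fun τ => Φ (ρ * cst2 σ τ)).sum).sum = 36 * ∑ ρ : LPerm (U ⊕ V), Φ ρ := by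
  simp only [perms3E, List.map, List.sum_cons, List.sum_nil, add_zero, sum_add_distrib, sum_lperm_cst2]
  ring

/-! ## §3  A sum over `LPerm (U ⊕ V)` is a double sum over the components -/

/-- The equivalence `LPerm (U ⊕ V) ≃ LPerm U × LPerm V`. [this work] -/
def lpermProd : LPerm (U ⊕ V) ≃ LPerm U × LPerm V := Equiv.sumArrowEquivProdArrow U V (Equiv.Perm (Fin 3))

omit [Fintype U] [DecidableEq U] [Fintype V] [DecidableEq V] in
/-- `lpermProd ρ = (rU ρ, rV ρ)`. [this work] -/
@[simp] theorem lpermProd_apply (ρ : LPerm (U ⊕ V)) : lpermProd ρ = (rU ρ, rV ρ) := rfl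

omit [Fintype U] [DecidableEq U] [Fintype V] [DecidableEq V] in
/-- Components of a glued index. [this work] -/
@[simp] theorem rU_elim (a : LPerm U) (b : LPerm V) : rU (Sum.elim a b) = a := rfl

omit [Fintype U] [DecidableEq U] [Fintype V] [DecidableEq V] in
/-- Components of a glued index. [this work] -/
@[simp] theorem rV_elim (a : LPerm U) (b : LPerm V) : rV (Sum.elim a b) = b := rfl

/-- **Double sum**: `Σ_ρ Φ(ρ_U, ρ_V) = Σ_{ρ_V} Σ_{ρ_U} Φ(ρ_U, ρ_V)`. [this work] -/
theorem sum_lperm_eq_sum_sum (Φ : LPerm U → LPerm V → ℤ) :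
    ∑ ρ : LPerm (U ⊕ V), Φ (rU ρ) (rV ρ) = ∑ b : LPerm V, ∑ a : LPerm U, Φ a b := by
  rw [← Equiv.sum_comp lpermProd.symm (fun ρ => Φ (rU ρ) (rV ρ)), Fintype.sum_prod_type, sum_comm]
  refine sum_congr rfl fun b _ => sum_congr rfl fun a _ => ?_
  simp [lpermProd, Equiv.sumArrowEquivProdArrow]

/-! ## §4  Conditional Harris inside one block, given the other block -/

/-- **Conditional Harris inside the `U`-block**: `K` an up-set of `[3]^U`, `L(ρ_V)` up-sets of `[3]^U`, weight `μ(z_U, ρ_V) ≥ 0`. [this work] -/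
theorem sum_lperm_condHarrisU {K : Finset (Pt U)} (hK : IsUpperSet (K : Set (Pt U))) (L : LPerm V → Finset (Pt U))
    (hL : ∀ b, IsUpperSet ((L b : Finset (Pt U)) : Set (Pt U))) (μ : Pt U → LPerm V → ℤ) (hμ : ∀ z b, 0 ≤ μ z b) :
    ∑ ρ : LPerm (U ⊕ V), μ (lpt (rU ρ) 2) (rV ρ) * (ind K (lpt (rU ρ) 0) * ind (L (rV ρ)) (lpt (rU ρ) 1)) ≤
      ∑ ρ : LPerm (U ⊕ V), μ (lpt (rU ρ) 2) (rV ρ) * (ind K (lpt (rU ρ) 0) * ind (L (rV ρ)) (lpt (rU ρ) 0)) := by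
  rw [sum_lperm_eq_sum_sum (fun a b => μ (lpt a 2) b * (ind K (lpt a 0) * ind (L b) (lpt a 1))),
    sum_lperm_eq_sum_sum (fun a b => μ (lpt a 2) b * (ind K (lpt a 0) * ind (L b) (lpt a 0)))]
  exact sum_le_sum fun b _ => sum_lperm_condHarris hK (hL b) (fun z => μ z b) (fun z => hμ z b)

/-- **Conditional Harris inside the `V`-block** (roles swapped). [this work] -/
theorem sum_lperm_condHarrisV {K : Finset (Pt V)} (hK : IsUpperSet (K : Set (Pt V))) (L : LPerm U → Finset (Pt V))
    (hL : ∀ a, IsUpperSet ((L a : Finset (Pt V)) : Set (Pt V))) (μ : Pt V → LPerm U → ℤ) (hμ : ∀ z a, 0 ≤ μ z a) :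
    ∑ ρ : LPerm (U ⊕ V), μ (lpt (rV ρ) 2) (rU ρ) * (ind K (lpt (rV ρ) 0) * ind (L (rU ρ)) (lpt (rV ρ) 1)) ≤
      ∑ ρ : LPerm (U ⊕ V), μ (lpt (rV ρ) 2) (rU ρ) * (ind K (lpt (rV ρ) 0) * ind (L (rU ρ)) (lpt (rV ρ) 0)) := by
  rw [sum_lperm_eq_sum_sum (fun a b => μ (lpt b 2) a * (ind K (lpt b 0) * ind (L a) (lpt b 1))),
    sum_lperm_eq_sum_sum (fun a b => μ (lpt b 2) a * (ind K (lpt b 0) * ind (L a) (lpt b 0))), sum_comm]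
  conv_rhs => rw [sum_comm]
  exact sum_le_sum fun a _ => sum_lperm_condHarris hK (hL a) (fun z => μ z a) (fun z => hμ z a)

/-! ## §5  `Ψ` as one Latin sum -/

/-- The integrand of `Ψ` on an ordered Latin triple `(x, y, z)`. [this work] -/
def psiD {κ : Type*} [DecidableEq κ] (F P b Q c : Finset κ) (x y z : κ) : ℤ :=
  2 * (ind F x * ind Q x * ind b x) + 2 * (ind F x * ind P x * ind c x) + 2 * (ind F x * ind b x * ind c x)
    - ind F x * ind P x * ind c y - ind F x * ind b x * ind Q y + 3 * (ind F x * ind b x * ind c y)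
    - ind F x * ind Q x * ind b y - ind F x * ind c x * ind P y + 3 * (ind F x * ind c x * ind b y)
    + ind F x * ind P y * ind c z + ind F x * ind b y * ind Q z - 3 * (ind F x * ind b y * ind c z)
    - ind F x * (ind Q y * ind b y) - ind F x * (ind P y * ind c y) - ind F x * (ind b y * ind c y)

/-- **`Ψ` is a Latin sum**: `Psi F P b Q c = Σ_ρ psiD F P b Q c (ρ·0) (ρ·1) (ρ·2)` (every `κ`). [this work] -/
theorem Psi_eq_sum_lperm {κ : Type*} [Fintype κ] [DecidableEq κ] (F P b Q c : Finset (Pt κ)) :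
    Psi F P b Q c = ∑ ρ : LPerm κ, psiD F P b Q c (lpt ρ 0) (lpt ρ 1) (lpt ρ 2) := by
  unfold Psi cSS cSO cOS cOO S1 latinPairs latinTriples psiD
  simp only [ind_inter, mul_sum]
  simp only [← sum_add_distrib, ← sum_sub_distrib, ← sum_neg_distrib]
  exact sum_congr rfl fun ρ _ => by ring

end product

end Summit.CriticalPhenomena.PercolationContinuityZ3.Theorems.SahiLatin
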